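import Summits.BirchSwinnertonDyer.BirchSwinnertonDyer.Theorems.Rank2Observatory2DescClCurveCert
import Summits.BirchSwinnertonDyer.BirchSwinnertonDyer.Theorems.Rank2Observatory2DescClCoreCert
import Summits.BirchSwinnertonDyer.BirchSwinnertonDyer.Theorems.Rank2Observatory2DescRowCertReal
import HarnessLib

/-!
# BirchSwinnertonDyer — rank ≥ 2 observatory: KERNEL-2DESC-CL v2.1 — records and checkers over a TOTALLY REAL 2-division field

HONEST FRAMING: per-curve certified theorems and census instruments; no claim on BSD in rank ≥ 2.

v2.0 of the class-group-general kernel 2-descent (`…2DescClFieldCert`, `…ClFamCert`, `…ClCurveCert`; design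
`b2b-bsdr2-cert-1/KERNEL-2DESC-CL.md` §7) handles curves `y² = F(x)` whose 2-division field `K = ℚ(θ_E)` is a
COMPLEX cubic field (one real place).  This file is §7.1 of the design: the same instrument when `K` is
TOTALLY REAL (`Δ(g) > 0`, three real places `ρ₀, ρ₁, ρ₂`, unit rank `2`).  Pure data and computable checkers,
zero mathematics:

* `ClFieldCertR` = the v2.0 field record `core : ClFieldCert` (its interval `(lo, hi)` now isolates `ρ₀(α)`
  and every stored sign bit refers to `ρ₀`) + the isolating intervals of `ρ₁(α)`, `ρ₂(α)` + the second
  fundamental unit `fu2` + the table `sgn` of sign bits at `ρ₁, ρ₂` of the family elements (keyed by their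
  coordinates);  `ClFieldCertR.check` = the signature-free core `core.checkCore` (`…ClCoreCert`) ∧ `Δ(g) > 0` ∧
  the three sign changes `g(lo₀) < 0 < g(hi₀)`, `g(lo₁) > 0 > g(hi₁)`, `g(lo₂) < 0 < g(hi₂)` on `0 ≤ loₖ < hiₖ`;
* `ClCurveCertR` = the v2.0 curve record `cc : ClCurveCert` + the `θ_E`-ORDER `(o₀, o₁, o₂)` of the places
  (`ρ_{o₀}(θ_E) < ρ_{o₁}(θ_E) < ρ_{o₂}(θ_E)`, certified by cert-2's interval test `linLtCond`, p341708);
* `famR` (the v2.0 family with `fu2` prepended), `famCheckR` (v2.0 `famCheck` ∧ the sign tests at `ρ₁, ρ₂`),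
  the parity matrix `bitR` (three sign rows, `ord_{W₁}`, `ord_{W₂}`, residue characters), the sieve `admR`
  (cert-2's three-real-place residue sieve `admStd3RQ`, p340704, in `θ_E`-order, ∧ the two `ord` parities) and
  the per-curve checker `checkR` (v2.0 `check` with `Δ(F) > 0`, the order clauses and the count `≤ 2²`).

Soundness (`rank E(ℚ) ≤ 2` / `= 2`) is the next file `…2DescClRealCertSound`.  Sorry-free, no axioms beyond
`propext`, `Classical.choice`, `Quot.sound`.
[cite: Cassels1991LecturesEllipticCurves, §15] [cite: Cohen1993, §6.5] [cite: CremonaAlgorithms1997, §3.6]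
-/

set_option linter.dupNamespace false

open scoped NumberField

open Literature.NumberTheory.NumberFields

namespace Summit.BirchSwinnertonDyer.BirchSwinnertonDyer.Rank2Observatory.TwoDescCl

open TwoDescCubic ClFieldCert

/-! ## The field record -/

/-- **Per-field certificate of a totally real monogenic cubic field** with auxiliary prime `q` (Design U):
the v2.0 record (place `ρ₀`) plus the data of the places `ρ₁, ρ₂` and the second unit. Pure data.
[cite: Cohen1993, §6.5] -/
structure ClFieldCertR where
  /-- the v2.0 record: `g`, `pIrr`, the interval of `ρ₀(α)`, `bM`, `q`, characters, `fu` (first unit), `gam`,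
  registry; all its sign bits are at `ρ₀` -/
  core : ClFieldCert
  /-- isolating interval `0 ≤ lo₂ < ρ₁(α) < hi₂` -/
  lo₂ : ℚ
  /-- isolating interval `0 ≤ lo₂ < ρ₁(α) < hi₂` -/
  hi₂ : ℚ
  /-- isolating interval `0 ≤ lo₃ < ρ₂(α) < hi₃` -/
  lo₃ : ℚ
  /-- isolating interval `0 ≤ lo₃ < ρ₂(α) < hi₃` -/
  hi₃ : ℚ
  /-- the second fundamental unit (`g`, sign bit at `ρ₀`, `δ = ε₂⁻¹`) -/
  fu2 : ElemEntry
  /-- sign bits at `ρ₁, ρ₂` (`true` = negative) of the family elements, keyed by coordinates -/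
  sgn : List ((ℤ × ℤ × ℤ) × Bool × Bool)

namespace ClFieldCertR

variable (fr : ClFieldCertR)

/-- Sign bit at `ρ₁` of the element with coordinates `g` (table lookup; `false` if absent). -/
def sg₂ (g : ℤ × ℤ × ℤ) : Bool :=
  match fr.sgn.find? fun e => e.1 == g with
  | some e => e.2.1
  | none => false

/-- Sign bit at `ρ₂` of the element with coordinates `g` (table lookup; `false` if absent). -/
def sg₃ (g : ℤ × ℤ × ℤ) : Bool :=
  match fr.sgn.find? fun e => e.1 == g with
  | some e => e.2.2
  | none => false

/-- The three isolating intervals, indexed by place. -/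
def I (k : Fin 3) : ℚ × ℚ :=
  if k = 0 then (fr.core.lo, fr.core.hi) else if k = 1 then (fr.lo₂, fr.hi₂) else (fr.lo₃, fr.hi₃)

/-- Archimedean clause of a totally real cubic: `Δ(g) > 0` and three sign changes of `g` on non-negative
intervals (`−, +` / `+, −` / `−, +`). Computable. [folklore] -/
def checkArch : Bool :=
  decide (0 < MonicCubic.disc fr.core.a fr.core.b fr.core.c) &&
  decide (0 ≤ fr.core.lo ∧ fr.core.lo < fr.core.hi ∧
    fr.core.lo ^ 3 + (fr.core.a : ℚ) * fr.core.lo ^ 2 + (fr.core.b : ℚ) * fr.core.lo + (fr.core.c : ℚ) < 0 ∧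
    0 < fr.core.hi ^ 3 + (fr.core.a : ℚ) * fr.core.hi ^ 2 + (fr.core.b : ℚ) * fr.core.hi + (fr.core.c : ℚ)) &&
  decide (0 ≤ fr.lo₂ ∧ fr.lo₂ < fr.hi₂ ∧
    0 < fr.lo₂ ^ 3 + (fr.core.a : ℚ) * fr.lo₂ ^ 2 + (fr.core.b : ℚ) * fr.lo₂ + (fr.core.c : ℚ) ∧
    fr.hi₂ ^ 3 + (fr.core.a : ℚ) * fr.hi₂ ^ 2 + (fr.core.b : ℚ) * fr.hi₂ + (fr.core.c : ℚ) < 0) &&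
  decide (0 ≤ fr.lo₃ ∧ fr.lo₃ < fr.hi₃ ∧
    fr.lo₃ ^ 3 + (fr.core.a : ℚ) * fr.lo₃ ^ 2 + (fr.core.b : ℚ) * fr.lo₃ + (fr.core.c : ℚ) < 0 ∧
    0 < fr.hi₃ ^ 3 + (fr.core.a : ℚ) * fr.hi₃ ^ 2 + (fr.core.b : ℚ) * fr.hi₃ + (fr.core.c : ℚ))

/-- **The per-field checker (totally real case)**: signature-free core ∧ archimedean clause. Computable; run
once per field by `decide +kernel`. -/
def check : Bool := fr.core.checkCore && fr.checkArch

end ClFieldCertR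

/-! ## The curve record, the family, the parity matrix, the sieve, the checker -/

/-- **Per-curve certificate over a totally real field**: the v2.0 record and the `θ_E`-order of the places. -/
structure ClCurveCertR where
  /-- the v2.0 per-curve record -/
  cc : ClCurveCert
  /-- `ρ_{o₀}(θ_E) < ρ_{o₁}(θ_E) < ρ_{o₂}(θ_E)` -/
  o₀ : Fin 3
  /-- `ρ_{o₀}(θ_E) < ρ_{o₁}(θ_E) < ρ_{o₂}(θ_E)` -/
  o₁ : Fin 3
  /-- `ρ_{o₀}(θ_E) < ρ_{o₁}(θ_E) < ρ_{o₂}(θ_E)` -/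
  o₂ : Fin 3

/-- **The `T`-unit family** over a totally real field: the second unit, then the v2.0 family
`−1, ε₁, γ, q, g_P (P ∈ codes)`. -/
def famR (fr : ClFieldCertR) (cc : ClCurveCert) : List FamEntry :=
  (0, ((0 : ℕ), (0 : ℤ), (0 : ℤ), (0 : ℤ)), fr.fu2) :: fam fr.core cc

/-- **Family-entry check (totally real)**: the v2.0 check (sign test at `ρ₀` included) and the sign tests at
`ρ₁`, `ρ₂` against the table bits. Computable. -/
def famCheckR (fr : ClFieldCertR) (D : ℤ × ℤ × ℤ) (f : FamEntry) : Bool :=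
  famCheck fr.core D f && signCond fr.lo₂ fr.hi₂ f.2.2.g (fr.sg₂ f.2.2.g) &&
    signCond fr.lo₃ fr.hi₃ f.2.2.g (fr.sg₃ f.2.2.g)

/-- The sign bit of an entry at place `k`. -/
def sgAt (fr : ClFieldCertR) (f : FamEntry) (k : Fin 3) : Bool :=
  if k = 0 then f.2.2.sg else if k = 1 then fr.sg₂ f.2.2.g else fr.sg₃ f.2.2.g

/-- Row `k` of the parity matrix at the entry `f`: `0, 1, 2` the signs at `ρ₀, ρ₁, ρ₂`, `3` parity of
`ord_{W₁}`, `4` parity of `ord_{W₂}`, `5 + i` the Euler bit of the `i`-th residue character. -/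
def bitRowR (fr : ClFieldCertR) (f : FamEntry) : ℕ → Bool
  | 0 => f.2.2.sg
  | 1 => fr.sg₂ f.2.2.g
  | 2 => fr.sg₃ f.2.2.g
  | 3 => !decide ((2 : ℤ) ∣ famL₁ f)
  | 4 => !decide ((2 : ℤ) ∣ famL₂ f)
  | k + 5 => eulerBit (fr.core.chars.getD k (3, 0, 0)).1 (evalInt (fr.core.chars.getD k (3, 0, 0)).2.1 f.2.2.g)

/-- The parity matrix of the family. -/
def bitR (fr : ClFieldCertR) (cc : ClCurveCert) (k : Fin (fr.core.chars.length + 5))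
    (j : Fin (famR fr cc).length) : Bool :=
  bitRowR fr ((famR fr cc).get j) k

/-- The norms of the family. -/
def famNormR (fr : ClFieldCertR) (cc : ClCurveCert) (j : Fin (famR fr cc).length) : ℤ :=
  normFormZ fr.core.a fr.core.b fr.core.c ((famR fr cc).get j).2.2.g.1 ((famR fr cc).get j).2.2.g.2.1
    ((famR fr cc).get j).2.2.g.2.2

/-- **The sieve** on pairs `(T, U)` (`T = ∅`; the units sit in the family): norm-square residues modulo `Q`
and the three-real-place sign conditions in `θ_E`-order (`admStd3RQ`), parities of `ord_{W₁}`, `ord_{W₂}`. -/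
def admR (fr : ClFieldCertR) (ccr : ClCurveCertR) (T : Finset (Fin 0))
    (U : Finset (Fin (famR fr ccr.cc).length)) : Bool :=
  admStd3RQ ccr.cc.Q (fun i : Fin 0 => i.elim0) (famNormR fr ccr.cc) (fun i : Fin 0 => i.elim0)
      (fun i : Fin 0 => i.elim0) (fun i : Fin 0 => i.elim0)
      (fun j => sgAt fr ((famR fr ccr.cc).get j) ccr.o₀) (fun j => sgAt fr ((famR fr ccr.cc).get j) ccr.o₁)
      (fun j => sgAt fr ((famR fr ccr.cc).get j) ccr.o₂) T U &&
    decide (Even (U.filter fun j => bitRowR fr ((famR fr ccr.cc).get j) 3 = true).card) &&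
    decide (Even (U.filter fun j => bitRowR fr ((famR fr ccr.cc).get j) 4 = true).card)

/-- **The per-curve checker over a totally real field.** Computable; run by `decide +kernel`.
[cite: Cassels1991LecturesEllipticCurves, §15] -/
def checkR (fr : ClFieldCertR) (ccr : ClCurveCertR) : Bool :=
  decide (deltaShort ccr.cc.A ccr.cc.B ccr.cc.C ≠ 0) &&
    noRootMod ccr.cc.pF ccr.cc.A ccr.cc.B ccr.cc.C &&
    decide (cubicAtCoords fr.core.a fr.core.b fr.core.c ccr.cc.A ccr.cc.B ccr.cc.C ccr.cc.t = (0, 0, 0)) &&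
    decide (derivAtCoords fr.core.a fr.core.b fr.core.c ccr.cc.A ccr.cc.B ccr.cc.t =
      MonicCubic.mulCoords fr.core.a fr.core.b fr.core.c ccr.cc.D (prodPowCoords fr.core.a fr.core.b fr.core.c [])) &&
    decide (0 < MonicCubic.disc ccr.cc.A ccr.cc.B ccr.cc.C) &&
    decide (normFormZ fr.core.a fr.core.b fr.core.c ccr.cc.D.1 ccr.cc.D.2.1 ccr.cc.D.2.2 ≠ 0) &&
    decide ((normFormZ fr.core.a fr.core.b fr.core.c ccr.cc.D.1 ccr.cc.D.2.1 ccr.cc.D.2.2).natAbs =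
      (ccr.cc.dn.map fun pe => pe.1 ^ pe.2).prod) &&
    (ccr.cc.dn.all fun pe => (fr.core.primes.any fun e => e.p == pe.1) &&
      ((fr.core.row pe.1).codes.all fun C' => decide (C' ∈ ccr.cc.codes) ||
        ccr.cc.dinv.any fun ci => ci.1 == C' && invCert fr.core.a fr.core.b fr.core.c C' ccr.cc.D ci.2)) &&
    (ccr.cc.codes.all fun C => (fr.core.primes.any fun e => e.p == C.1) && decide (C ∈ (fr.core.row C.1).codes)) &&
    invCert fr.core.a fr.core.b fr.core.c fr.core.w₁ ccr.cc.D ccr.cc.dW1 &&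
    invCert fr.core.a fr.core.b fr.core.c fr.core.w₂ ccr.cc.D ccr.cc.dW2 &&
    (ccr.cc.Q.all fun q => decide (0 < q)) &&
    ((famR fr ccr.cc).all fun f => famCheckR fr ccr.cc.D f) &&
    (linLtCond (fr.I ccr.o₀).1 (fr.I ccr.o₀).2 (fr.I ccr.o₁).1 (fr.I ccr.o₁).2 ccr.cc.t &&
      linLtCond (fr.I ccr.o₁).1 (fr.I ccr.o₁).2 (fr.I ccr.o₂).1 (fr.I ccr.o₂).2 ccr.cc.t) &&
    decide (∀ T : Finset (Fin (famR fr ccr.cc).length), T ≠ ∅ →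
      ∃ k : Fin (fr.core.chars.length + 5), Odd (T.filter fun j => bitR fr ccr.cc k j = true).card) &&
    decide (((Finset.univ ×ˢ Finset.univ).filter
      (fun p : Finset (Fin 0) × Finset (Fin (famR fr ccr.cc).length) => admR fr ccr p.1 p.2 = true)).card ≤ 2 ^ 2)

end Summit.BirchSwinnertonDyer.BirchSwinnertonDyer.Rank2Observatory.TwoDescCl
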